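import Mathlib
import Literature.Analysis.TotalPositivity.MultiplyPositiveProofs
import Literature.LinearAlgebra.Matrix.GramDeterminantKernel
import Summits.ValiantsHypothesis.ValiantsHypothesis.Theorems.LacunarySymmetroidMatrixDescartesDetLorentzianNonneg
import HarnessLib

/-!
# Crux `MatrixDescartes` (stmt-ValiantsHypothesis-18050, the summit's V1), line
# `Cruxes/MatrixDescartes/Lines/lorentzian_shadow.lean`, toward the KNOWN stub `stub_detLorentzian` —
# [M2] necessity half of clause (c): the support of `det Σ_l X_l A_l` (`A_l ⪰ 0`) lies in the RANK POLYMATROID,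
# and the rank function `S ↦ rank (Σ_{l∈S} A_l)` is submodular

HONEST FRAMING.  Helper lemmas (`--supports stmt-ValiantsHypothesis-18050 --as helper`; merged desk RULING #86,
2026-08-28) on a registered ALTERNATIVE line of V1; 0 definitions / 0 named facts.  Clause (c) of
`IsLorentzianArray m K (detArray m K A)` is NOT proved: with `…PolymatroidExchange.lean` ([M1]: integer points of
a submodular base polytope are M-convex) and this file ([M2]: `supp detArray ⊆` the rank polymatroid, and the rank
function is submodular) the RESIDUAL of (c) is exactly the SUFFICIENCY `{α ∈ Δ(m,K) | ∀ S, Σ_{l∈S} α_l ≤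
rank (Σ_{l∈S} A_l)} ⊆ supp detArray` (Rado's theorem / matroid intersection with the colour partition — Panov's
criterion for mixed discriminants; size L), plus clause (d) (Hessian signature; Brändén–Huh).  `stub_detLorentzian`,
the law stubs, `MatrixDescartes`, Conjecture B and `VP ≠ VNP` are OPEN; nothing here bears on them.

* `det_pencil_eq_sum_sq` — Cauchy–Binet expansion `det Σ_l X_l A_l = Σ_t C (det Bst_t)² ∏_i X_{l(t i)}` for
  `A_l = B_lᵀ B_l` (the tree's `Literature.Analysis.TotalPositivity.det_mul_eq_sum_strictMono`).
* `exists_minor_of_coeff_ne_zero` — a non-zero coefficient is carried by a nonsingular row selection of its type.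
* `exists_gram_blocks` — blockwise Gram factorisation `Σ_{l∈S} A_l = Bst_Sᵀ Bst_S` for every colour set `S`.
* `card_le_rank_of_det_ne_zero` — rows of colour in `S` of a nonsingular selection are independent in `Bst_S`.
* **`sum_le_rank_of_coeff_det_pencil_ne_zero` / `sum_le_rank_of_detArray_ne_zero`** — [M2] (line currency:
  `detArray` UNFOLDED): `detArray A α ≠ 0 ⇒ ∀ S, Σ_{l∈S} α_l ≤ rank (Σ_{l∈S} A_l)`.
* **`rank_sum_submodular`** — `rank (Σ_{S∪T} A) + rank (Σ_{S∩T} A) ≤ rank (Σ_S A) + rank (Σ_T A)` for PSD families.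
[cite: BorceaBranden2009, Prop. 2.4; Murota, Discrete Convex Analysis (2003) §4.4; folklore]
-/

set_option linter.dupNamespace false
set_option autoImplicit false

noncomputable section

namespace Summit.ValiantsHypothesis.ValiantsHypothesis.Theorems.LacunarySymmetroidMatrixDescartes

namespace DetLorentzian

open Matrix Finset MvPolynomial

/-- **Cauchy–Binet expansion of the Gram pencil**: with `A_l = B_lᵀ B_l` and the stacked `Bst`,
`det Σ_l X_l A_l = Σ_t C (det Bst_t)² · ∏_i X_{l(t i)}` over increasing `t : Fin m → Fin (K·m)`. [folklore;
cite: BorceaBranden2009, Prop. 2.4 (proof)] -/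
theorem det_pencil_eq_sum_sq {m K : ℕ} (A B : Fin K → Matrix (Fin m) (Fin m) ℝ) (hB : ∀ l, A l = (B l)ᵀ * B l)
    (Bst : Matrix (Fin (K * m)) (Fin m) ℝ)
    (hBst : ∀ r j, Bst r j = B (finProdFinEquiv.symm r).1 (finProdFinEquiv.symm r).2 j) :
    Matrix.det (∑ l, (X l : MvPolynomial (Fin K) ℝ) • (A l).map C) =
      ∑ t ∈ (univ : Finset (Fin m → Fin (K * m))).filter (fun t => StrictMono t),
        C ((Bst.submatrix t id).det * (Bst.submatrix t id).det) *
          ∏ i, (X (finProdFinEquiv.symm (t i)).1 : MvPolynomial (Fin K) ℝ) := by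
  classical
  rw [pencil_eq_gram A B hB Bst hBst, Literature.Analysis.TotalPositivity.det_mul_eq_sum_strictMono]
  refine Finset.sum_congr rfl fun t _ => ?_
  set N : Matrix (Fin (K * m)) (Fin m) (MvPolynomial (Fin K) ℝ) := Bst.map C with hN
  set D : Matrix (Fin (K * m)) (Fin (K * m)) (MvPolynomial (Fin K) ℝ) :=
    diagonal fun r => X (finProdFinEquiv.symm r).1 with hD
  have hsub : (D * N).submatrix t id =
      diagonal (fun i => (X (finProdFinEquiv.symm (t i)).1 : MvPolynomial (Fin K) ℝ)) * N.submatrix t id := by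
    ext i j
    simp only [submatrix_apply, id, hD, diagonal_mul]
  have hdet : (N.submatrix t id).det = C ((Bst.submatrix t id).det) := by
    rw [hN, submatrix_map]
    exact (RingHom.map_det (C : ℝ →+* MvPolynomial (Fin K) ℝ) (Bst.submatrix t id)).symm
  rw [← transpose_submatrix, det_transpose, hsub, det_mul, det_diagonal, hdet, map_mul]
  ring

/-- If a coefficient of `det Σ_l X_l A_l` is non-zero, some Cauchy–Binet term carries it: there is an increasing
row selection `t` of the stacked Gram factor with `det Bst_t ≠ 0` and colour type `d`. [folklore] -/
theorem exists_minor_of_coeff_ne_zero {m K : ℕ} (A B : Fin K → Matrix (Fin m) (Fin m) ℝ)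
    (hB : ∀ l, A l = (B l)ᵀ * B l) (Bst : Matrix (Fin (K * m)) (Fin m) ℝ)
    (hBst : ∀ r j, Bst r j = B (finProdFinEquiv.symm r).1 (finProdFinEquiv.symm r).2 j)
    (d : Fin K →₀ ℕ) (hd : coeff d (Matrix.det (∑ l, (X l : MvPolynomial (Fin K) ℝ) • (A l).map C)) ≠ 0) :
    ∃ t : Fin m → Fin (K * m), (Bst.submatrix t id).det ≠ 0 ∧
      (∑ i, Finsupp.single (finProdFinEquiv.symm (t i)).1 1) = d := by
  classical
  rw [det_pencil_eq_sum_sq A B hB Bst hBst, coeff_sum] at hd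
  obtain ⟨t, -, ht⟩ := Finset.exists_ne_zero_of_sum_ne_zero hd
  rw [prod_X_eq_monomial, coeff_C_mul, coeff_monomial] at ht
  refine ⟨t, ?_, ?_⟩
  · intro h
    apply ht
    rw [h, mul_zero, zero_mul]
  · by_contra h
    apply ht
    rw [if_neg h, mul_zero]

/-- **Gram factor of a PSD family, blockwise**: for `A_l ⪰ 0` there are `B_l` with `A_l = B_lᵀ B_l`, and for the
stacked `Bst` and every colour set `S`, `Σ_{l∈S} A_l = Bst_Sᵀ Bst_S` with `Bst_S` the rows of colour in `S`.
[folklore] -/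
theorem exists_gram_blocks {m K : ℕ} (A : Fin K → Matrix (Fin m) (Fin m) ℝ) (hA : ∀ l, (A l).PosSemidef) :
    ∃ (B : Fin K → Matrix (Fin m) (Fin m) ℝ) (Bst : Matrix (Fin (K * m)) (Fin m) ℝ),
      (∀ l, A l = (B l)ᵀ * B l) ∧
      (∀ r j, Bst r j = B (finProdFinEquiv.symm r).1 (finProdFinEquiv.symm r).2 j) ∧
      ∀ S : Finset (Fin K),
        ∑ l ∈ S, A l =
          ((Bst.submatrix (Subtype.val : {r : Fin (K * m) // (finProdFinEquiv.symm r).1 ∈ S} → Fin (K * m)) id)ᵀ :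
              Matrix (Fin m) {r : Fin (K * m) // (finProdFinEquiv.symm r).1 ∈ S} ℝ) *
            (Bst.submatrix (Subtype.val : {r : Fin (K * m) // (finProdFinEquiv.symm r).1 ∈ S} → Fin (K * m)) id :
              Matrix {r : Fin (K * m) // (finProdFinEquiv.symm r).1 ∈ S} (Fin m) ℝ) := by
  classical
  have hB : ∀ l, ∃ B : Matrix (Fin m) (Fin m) ℝ, A l = Bᵀ * B := by
    intro l
    obtain ⟨R, hR⟩ := Literature.LinearAlgebra.Matrix.exists_eq_conjTranspose_mul_self_of_posSemidef (hA l)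
    exact ⟨R, by rw [hR, conjTranspose_eq_transpose_of_trivial]⟩
  choose B hB using hB
  refine ⟨B, Matrix.of fun r j => B (finProdFinEquiv.symm r).1 (finProdFinEquiv.symm r).2 j, hB,
    fun r j => rfl, fun S => ?_⟩
  refine Matrix.ext fun j j' => ?_
  rw [Matrix.mul_apply, Matrix.sum_apply]
  simp only [transpose_apply, submatrix_apply, id, Matrix.of_apply]
  have hl : ∀ l, A l j j' = ∑ i, B l i j * B l i j' := fun l => by
    rw [hB l, Matrix.mul_apply]
    simp only [transpose_apply]
  simp_rw [hl]
  -- RHS: sum over the subtype of rows with colour in `S`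
  rw [← Finset.sum_subtype (univ.filter fun r : Fin (K * m) => (finProdFinEquiv.symm r).1 ∈ S)
    (by intro r; simp)
    (fun r : Fin (K * m) => B (finProdFinEquiv.symm r).1 (finProdFinEquiv.symm r).2 j *
      B (finProdFinEquiv.symm r).1 (finProdFinEquiv.symm r).2 j'),
    Finset.sum_filter, ← finProdFinEquiv.sum_comp]
  simp only [Equiv.symm_apply_apply, Fintype.sum_prod_type]
  have hinner : ∀ l : Fin K, (∑ i : Fin m, if l ∈ S then B l i j * B l i j' else 0) =
      if l ∈ S then ∑ i, B l i j * B l i j' else 0 := fun l => by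
    split_ifs <;> simp
  simp_rw [hinner]
  rw [Finset.sum_ite_mem, Finset.univ_inter]


/-- Inside a nonsingular `m`-row selection `t` of the stacked factor, the rows of colour in `S` are linearly
independent rows of the `S`-block, so their number bounds its rank. [folklore] -/
theorem card_le_rank_of_det_ne_zero {m K : ℕ} (Bst : Matrix (Fin (K * m)) (Fin m) ℝ) (t : Fin m → Fin (K * m))
    (ht : (Bst.submatrix t id).det ≠ 0) (S : Finset (Fin K)) :
    Fintype.card {i : Fin m // (finProdFinEquiv.symm (t i)).1 ∈ S} ≤
      (Bst.submatrix (Subtype.val : {r : Fin (K * m) // (finProdFinEquiv.symm r).1 ∈ S} → Fin (K * m)) id :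
        Matrix {r : Fin (K * m) // (finProdFinEquiv.symm r).1 ∈ S} (Fin m) ℝ).rank := by
  classical
  set BS : Matrix {r : Fin (K * m) // (finProdFinEquiv.symm r).1 ∈ S} (Fin m) ℝ :=
    Bst.submatrix (Subtype.val : {r : Fin (K * m) // (finProdFinEquiv.symm r).1 ∈ S} → Fin (K * m)) id
    with hBS
  have hli : LinearIndependent ℝ (fun i : Fin m => (Bst.submatrix t id) i) :=
    Matrix.linearIndependent_rows_of_det_ne_zero ht
  have hli' : LinearIndependent ℝ
      (fun i : {i : Fin m // (finProdFinEquiv.symm (t i)).1 ∈ S} => BS ⟨t i.1, i.2⟩) := by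
    have h := hli.comp (Subtype.val : {i : Fin m // (finProdFinEquiv.symm (t i)).1 ∈ S} → Fin m)
      Subtype.val_injective
    convert h using 1
    funext i
    rw [hBS]
    rfl
  rw [Matrix.rank_eq_finrank_span_row, ← finrank_span_eq_card hli']
  refine Submodule.finrank_mono (Submodule.span_mono ?_)
  rintro _ ⟨i, rfl⟩
  exact ⟨⟨t i.1, i.2⟩, rfl⟩

/-- **[M2] Necessity half of clause (c)** (Panov's rank condition): if the coefficient of `s^d` in
`det Σ_l s_l A_l` (`A_l ⪰ 0`) is non-zero, then `Σ_{l∈S} d_l ≤ rank (Σ_{l∈S} A_l)` for every colour set `S`.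
Proof: a non-vanishing Cauchy–Binet term gives a nonsingular row selection of the stacked Gram factor of colour
type `d`; its rows of colour in `S` are independent rows of the `S`-block `Bst_S`, and
`rank (Σ_{l∈S} A_l) = rank (Bst_Sᵀ Bst_S) = rank Bst_S` (`Matrix.rank_transpose_mul_self`).
[folklore; the rank condition is Panov's (1987) criterion for mixed discriminants, necessity half] -/
theorem sum_le_rank_of_coeff_det_pencil_ne_zero {m K : ℕ} (A : Fin K → Matrix (Fin m) (Fin m) ℝ)
    (hA : ∀ l, (A l).PosSemidef) (d : Fin K →₀ ℕ)
    (hd : coeff d (Matrix.det (∑ l, (X l : MvPolynomial (Fin K) ℝ) • (A l).map C)) ≠ 0)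
    (S : Finset (Fin K)) : ∑ l ∈ S, d l ≤ (∑ l ∈ S, A l).rank := by
  classical
  obtain ⟨B, Bst, hB, hBst, hGram⟩ := exists_gram_blocks A hA
  obtain ⟨t, ht, htype⟩ := exists_minor_of_coeff_ne_zero A B hB Bst hBst d hd
  rw [hGram S, Matrix.rank_transpose_mul_self]
  refine le_trans (le_of_eq ?_) (card_le_rank_of_det_ne_zero Bst t ht S)
  rw [← htype, Fintype.card_subtype]
  simp only [Finsupp.finsetSum_apply, Finsupp.single_apply]
  rw [Finset.sum_comm, Finset.card_filter]
  refine Finset.sum_congr rfl fun i _ => ?_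
  rw [Finset.sum_ite_eq]

/-- **[M2] in the line's currency** (`detArray m K A α ≠ 0` UNFOLDED): a support point `α` of the coefficient
array of `det Σ_l X_l A_l`, `A_l ⪰ 0`, satisfies `Σ_{l∈S} α_l ≤ rank (Σ_{l∈S} A_l)` for all `S`.  RESIDUAL of
clause (c) after this file and `…PolymatroidExchange.lean`: the converse (Rado / matroid intersection:
every `α ∈ Δ(m,K)` inside the rank polymatroid IS a support point) — then `polymatroid_isMConvexOn_layer` with
`f S = rank (Σ_{l∈S} A_l)` (submodular: `rank_sum_submodular`) is clause (c). [folklore] -/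
theorem sum_le_rank_of_detArray_ne_zero (m K : ℕ) (A : Fin K → Matrix (Fin m) (Fin m) ℝ)
    (hA : ∀ l, (A l).PosSemidef) (α : Fin K → ℕ)
    (hα : MvPolynomial.coeff (Finsupp.equivFunOnFinite.symm α)
      (Matrix.det (∑ l, (MvPolynomial.X l : MvPolynomial (Fin K) ℝ) • (A l).map MvPolynomial.C)) ≠ 0)
    (S : Finset (Fin K)) : ∑ l ∈ S, α l ≤ (∑ l ∈ S, A l).rank := by
  have h := sum_le_rank_of_coeff_det_pencil_ne_zero A hA _ hα S
  simpa only [Finsupp.coe_equivFunOnFinite_symm] using h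

/-- **The rank function `S ↦ rank (Σ_{l∈S} A_l)` of a PSD family is submodular** (it is the dimension of the
span of the rows of colour in `S` of the stacked Gram factor; `dim (U ⊔ V) + dim (U ⊓ V) = dim U + dim V`).
[folklore] -/
theorem rank_sum_submodular {m K : ℕ} (A : Fin K → Matrix (Fin m) (Fin m) ℝ) (hA : ∀ l, (A l).PosSemidef)
    (S T : Finset (Fin K)) :
    (∑ l ∈ S ∪ T, A l).rank + (∑ l ∈ S ∩ T, A l).rank ≤ (∑ l ∈ S, A l).rank + (∑ l ∈ T, A l).rank := by
  classical
  obtain ⟨B, Bst, hB, hBst, hGram⟩ := exists_gram_blocks A hA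
  -- the row space of colour set `S`
  have hW : ∀ S : Finset (Fin K), (∑ l ∈ S, A l).rank =
      Module.finrank ℝ (Submodule.span ℝ ((fun r : Fin (K * m) => Bst r) ''
        {r | (finProdFinEquiv.symm r).1 ∈ S})) := by
    intro S
    rw [hGram S, Matrix.rank_transpose_mul_self, Matrix.rank_eq_finrank_span_row, Set.image_eq_range]
    rfl
  rw [hW, hW, hW, hW]
  have hU : {r : Fin (K * m) | (finProdFinEquiv.symm r).1 ∈ S ∪ T} =
      {r | (finProdFinEquiv.symm r).1 ∈ S} ∪ {r | (finProdFinEquiv.symm r).1 ∈ T} := by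
    ext r; simp
  have hI : {r : Fin (K * m) | (finProdFinEquiv.symm r).1 ∈ S ∩ T} =
      {r | (finProdFinEquiv.symm r).1 ∈ S} ∩ {r | (finProdFinEquiv.symm r).1 ∈ T} := by
    ext r; simp
  rw [hU, hI, Set.image_union, Submodule.span_union]
  have hle : Submodule.span ℝ ((fun r : Fin (K * m) => Bst r) ''
        ({r | (finProdFinEquiv.symm r).1 ∈ S} ∩ {r | (finProdFinEquiv.symm r).1 ∈ T})) ≤
      Submodule.span ℝ ((fun r : Fin (K * m) => Bst r) '' {r | (finProdFinEquiv.symm r).1 ∈ S}) ⊓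
        Submodule.span ℝ ((fun r : Fin (K * m) => Bst r) '' {r | (finProdFinEquiv.symm r).1 ∈ T}) :=
    le_inf (Submodule.span_mono (Set.image_mono Set.inter_subset_left))
      (Submodule.span_mono (Set.image_mono Set.inter_subset_right))
  have h1 := Submodule.finrank_mono hle
  have h2 := Submodule.finrank_sup_add_finrank_inf_eq
    (Submodule.span ℝ ((fun r : Fin (K * m) => Bst r) '' {r | (finProdFinEquiv.symm r).1 ∈ S}))
    (Submodule.span ℝ ((fun r : Fin (K * m) => Bst r) '' {r | (finProdFinEquiv.symm r).1 ∈ T}))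
  omega

end DetLorentzian

end Summit.ValiantsHypothesis.ValiantsHypothesis.Theorems.LacunarySymmetroidMatrixDescartes

end
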